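import Literature.Probability.Percolation.ArmEventsReimer
import Literature.Probability.Percolation.NearCriticalOneArmAPriori
import Literature.Probability.Percolation.NearCriticalFourArmFactsSymm
import HarnessLib

/-!
# The four-arm lower bound below `L(p)` from five arms with three open arms (either side of `1/2`)

Topic `Literature/Probability/Percolation`; family `crit-perc`, statement **crit-perc.S16**
(`Literature.Probability.Percolation.triTheta_exponent`). PROOFS ONLY (no new definition, no new
named fact). Companion of `ArmEventsReimer.lean`, whose `Werner2009_fourArm_lowerBound_of_fiveArm`
derives W. Werner's a priori four-arm lower bound below `L(p)` (*Lectures on two-dimensional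
critical percolation*, PCMI 2009, Lecture 6, §3, third estimate; the tree's named fact
`Werner2009_fourArm_lowerBound`, `NearCriticalFourArmFacts.lean`) from the five-arm lower bound
`c (m/n)² ≤ P_t(armEvent (T,F,T,F,F) m n)` — TWO open and THREE closed arms, `t ∈ [1/2, 1/2 + δ)` —
by splitting off the decreasing closed arm with Reimer's inequality. The lowest-crossing
construction of the five-arm site (P. Nolin, EJP 13 (2008), proof of Thm. 24 (ii) [arXiv
0711.4948: Thm. 23 (ii), p. 17]; in the tree `exists_forall_relabel_shift_mem_armEvent_five`,
`FiveArmShift.lean`, and `real_fiveArmSite_ge`, `FiveArmEvent.lean`) produces instead THREE OPEN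
and TWO CLOSED arms, the tree's `armEvent ![true, true, true, false, false]` (two open halves of
the lowest open crossing, the closed cluster below, an open and a closed arm above). This file
records the three ways of feeding such a bound into `Werner2009_fourArm_lowerBound`:

* `Werner2009_fourArm_lowerBound_of_fiveArm_threeOpen` — from the bound for `(T,T,T,F,F)` on the
  RIGHT of `1/2` (`1/2 ≤ t < 1/2 + δ`, `n ≤ L(t, ε)` for `t > 1/2`): split off an OPEN arm,
  `P_t(A₅) ≤ π̂_t(m, n) · P_t(open arm)` (`real_fiveArm_threeOpen_le_fourArmProbAt_mul`, Reimer as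
  in Nolin 2008, §4.1, Rem. 5, after relabelling the arms, `armEvent_threeOpen_eq_append`), and
  bound the open arm near-critically by Nolin's Prop. 14 [arXiv: Prop. 13] below `L(t, ε)`
  (`exists_real_armEvent_one_le_rpow_lt_charLengthW`, `NearCriticalOneArmAPriori.lean`; Werner,
  Lecture 6, §3, first paragraph: the uniform RSW estimates below `L(p)` "imply uniform estimates
  for the probabilities of existence" of arms) — this is exactly Nolin's step in the proof of
  Thm. 27 [arXiv: Thm. 26] ("using Reimer's inequality and the a-priori bound for one arm").
* `Werner2009_fourArm_lowerBound_of_fiveArm_threeOpen_left` — from the bound for `(T,T,T,F,F)`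
  on the LEFT of `1/2` (`1/2 - δ < s ≤ 1/2`, `n ≤ L(s, ε)` for `s < 1/2`): colour exchange
  `ω ↦ ωᶜ` maps `P_s` to `P_{1-s}` and `(T,T,T,F,F)` to `(F,F,F,T,T)`, a relabelling of
  `(T,F,T,F,F)` (`real_fiveArm_symm`; Smirnov–Werner 2001, Rem. 2; Nolin 2008, §2.1, "`P̂` between
  `P_p` and `P_{1-p}`"), and `L(1 - s) = L(s)` (`charLengthW_symm`); then
  `Werner2009_fourArm_lowerBound_of_fiveArm`.
* `Werner2009_fourArm_lowerBound_of_fiveArm_threeOpen_twoSided` — from the two-sided form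
  (`|s - 1/2| < δ`, `n ≤ L(s, ε)` for `s ≠ 1/2`).

## References

* W. Werner, *Lectures on two-dimensional critical percolation*, IAS/Park City Math. Ser. 16
  (2009), Lecture 6, §3 (a priori estimates below `L(p)`), arXiv 0710.0856 p. 45 [WernerPCMI2009].
* P. Nolin, Near-critical percolation in two dimensions, *Electron. J. Probab.* 13 (2008), §2.1,
  §4.1 Rem. on Reimer's inequality, Prop. 14, Thm. 24 (ii), §6.2 proof of Thm. 27 [arXiv
  0711.4948: Rem. 5, Prop. 13, Thm. 23 (ii), Thm. 26] [Nolin2008].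
* S. Smirnov, W. Werner, Critical exponents for two-dimensional percolation, *Math. Res. Lett.* 8
  (2001), Rem. 2 ("Changing the colors") [SmirnovWernerMRL2001].

## Mathlib / tree

Tree: `real_armEvent_append_le_mul`, `Werner2009_fourArm_lowerBound_of_fiveArm`
(`ArmEventsReimer.lean`), `exists_real_armEvent_one_le_rpow_lt_charLengthW`
(`NearCriticalOneArmAPriori.lean`), `armEvent_comp_equiv`, `real_armEvent_symm`
(`NearCriticalFourArmFactsSymm.lean`), `charLengthW_symm` (`WernerCorrelationLength.lean`),
`fourArmProbAt`, `fourArmProbAt_nonneg` (`WernerPivotalEstimates(Proofs).lean`),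
`Werner2009_fourArm_lowerBound`, `charLengthW`. Mathlib: `unitInterval.symm_symm`,
`unitInterval.coe_symm_eq`, `Real.rpow_sub`, `Equiv`.
-/

noncomputable section

open MeasureTheory Set
open scoped unitInterval

namespace Literature.Probability.Percolation

open LatticeModels

/-! ### Relabelling: `(T,T,T,F,F)` versus `(T,F,T,F) ++ (T)` and versus the flip of `(T,F,T,F,F)` -/

/-- `(T,F,T,F) ++ (T) = (T,F,T,F,T)`. [folklore] -/
theorem fin_append_four_one_true :
    Fin.append ![true, false, true, false] ![true] = ![true, false, true, false, true] := by
  funext i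
  fin_cases i <;> rfl

/-- `(T,T,T,F,F)` is `(T,F,T,F,T)` relabelled along the permutation `0 ↦ 0, 1 ↦ 2, 2 ↦ 4, 3 ↦ 1,
4 ↦ 3` of the arm indices. [folklore] -/
theorem threeOpen_eq_comp_perm :
    (![true, true, true, false, false] : Fin 5 → Bool) =
      (![true, false, true, false, true] : Fin 5 → Bool) ∘
        (⟨![0, 2, 4, 1, 3], ![0, 3, 1, 4, 2], by decide, by decide⟩ : Fin 5 ≃ Fin 5) := by
  funext i
  fin_cases i <;> rfl

/-- **Three open and two closed arms are four alternating arms and an open arm, relabelled**: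
`armEvent (T,T,T,F,F) r R = armEvent ((T,F,T,F) ++ (T)) r R` (the tree's `armEvent` records no
cyclic order, `armEvent_comp_equiv`). [folklore] -/
theorem armEvent_threeOpen_eq_append (r R : ℕ) :
    armEvent ![true, true, true, false, false] r R =
      armEvent (Fin.append ![true, false, true, false] ![true]) r R := by
  rw [fin_append_four_one_true, threeOpen_eq_comp_perm, armEvent_comp_equiv]

/-- The flip of `(T,F,T,F,F)` is `(F,T,F,T,T)`, which is `(T,T,T,F,F)` relabelled along
`0 ↦ 3, 1 ↦ 0, 2 ↦ 4, 3 ↦ 1, 4 ↦ 2`. [folklore] -/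
theorem not_twoOpen_eq_threeOpen_comp_perm :
    (fun j => !(![true, false, true, false, false] : Fin 5 → Bool) j) =
      (![true, true, true, false, false] : Fin 5 → Bool) ∘
        (⟨![3, 0, 4, 1, 2], ![1, 3, 4, 0, 2], by decide, by decide⟩ : Fin 5 ≃ Fin 5) := by
  funext i
  fin_cases i <;> rfl

/-- **Colour exchange for five arms**: `P_{1-s}(armEvent (T,F,T,F,F) m n) = P_s(armEvent (T,T,T,F,F) m n)`
(`ω ↦ ωᶜ` maps `P_s` to `P_{1-s}` and flips the colours; Smirnov–Werner 2001, Rem. 2; Nolin 2008,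
§2.1). [cite: SmirnovWernerMRL2001, Rem. 2] [cite: Nolin2008, §2.1 (P̂ between P_p and P_{1-p})] -/
theorem real_fiveArm_symm (s : unitInterval) (m n : ℕ) :
    (triSitePercolation (σ s)).real (armEvent ![true, false, true, false, false] m n) =
      (triSitePercolation s).real (armEvent ![true, true, true, false, false] m n) := by
  rw [real_armEvent_symm, not_twoOpen_eq_threeOpen_comp_perm, armEvent_comp_equiv]

/-! ### Splitting off the open arm -/

/-- **Five arms with three open ones cost a four-arm probability times an open arm** (Reimer's
inequality, Nolin 2008, §4.1, Rem.: `P(A_{j+j',σσ'}) ≤ P(A_{j,σ}) P(A_{j',σ'})` "for any `P`"): for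
`m ≤ n` and every `t`, `P_t(armEvent (T,T,T,F,F) m n) ≤ π̂_t(m, n) · P_t(armEvent (T) m n)`. [cite: Nolin2008, §4.1, Remark on Reimer's inequality (arXiv 0711.4948: Rem. 5)] -/
theorem real_fiveArm_threeOpen_le_fourArmProbAt_mul (t : unitInterval) {m n : ℕ} (hmn : m ≤ n) :
    (triSitePercolation t).real (armEvent ![true, true, true, false, false] m n) ≤
      fourArmProbAt t m n * (triSitePercolation t).real (armEvent ![true] m n) := by
  rw [armEvent_threeOpen_eq_append]
  exact real_armEvent_append_le_mul t _ _ hmn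

/-- **The open arm decays polynomially below `L(t, ε)`, uniformly for `1/2 ≤ t < 3/4`** (Nolin
2008, Prop. 14, upper half, `j = 1` [arXiv: Prop. 13]; Werner 2009, Lecture 6, §3, ¶1), in the
quantifier format of the tree's near-critical facts: for every `ε > 0` there are `C, α > 0` with
`P_t(armEvent (T) m n) ≤ C (m/n)^α` for `1/2 ≤ t < 3/4`, `1 ≤ m ≤ n`, and `n ≤ L(t, ε)` whenever
`t > 1/2` (`exists_real_armEvent_one_le_rpow_lt_charLengthW`). [cite: Nolin2008, §4.3, Prop. 14 (arXiv 0711.4948: Prop. 13)] [cite: WernerPCMI2009, Lecture 6, §3 (first paragraph)] -/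
theorem exists_real_openArm_le_rpow_nearCritical {ε : ℝ} (hε : 0 < ε) :
    ∃ C α : ℝ, 0 < C ∧ 0 < α ∧ ∀ t : unitInterval, 1 / 2 ≤ (t : ℝ) → (t : ℝ) < 3 / 4 →
      ∀ m n : ℕ, 1 ≤ m → m ≤ n → (1 / 2 < (t : ℝ) → n ≤ charLengthW ε t) →
        (triSitePercolation t).real (armEvent ![true] m n) ≤ C * ((m : ℝ) / n) ^ α := by
  obtain ⟨C, α, hC, hα, h⟩ := exists_real_armEvent_one_le_rpow_lt_charLengthW hε
  refine ⟨C, α, hC, hα, fun t ht ht' m n hm hmn hL => h t true m n ?_ hm hmn fun hne => ?_⟩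
  · rw [abs_sub_lt_iff]
    constructor <;> linarith
  · exact hL (lt_of_le_of_ne ht (Ne.symm hne))

/-! ### `Werner2009_fourArm_lowerBound` from five arms with three open arms -/

/-- **`Werner2009_fourArm_lowerBound` from the five-arm lower bound with three open arms, right of
`1/2`** (Werner 2009, Lecture 6, §3, third a priori estimate, "four arms with alternating color …
bounded from below by a constant times `(m/n)^{2-β}`", from the five-arm bound; Nolin 2008, §6.2,
proof of Thm. 27: Reimer's inequality and the a priori one-arm bound). If for every small `ε` there
are `r₁, δ, c > 0` with `c (m/n)² ≤ P_t(armEvent (T,T,T,F,F) m n)` for `1/2 ≤ t < 1/2 + δ`,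
`r₁ ≤ m ≤ n`, `n ≤ L(t, ε)` when `t > 1/2`, then the named fact holds, with `β = α(ε)` the
near-critical one-arm exponent: `c (m/n)² ≤ π̂_t(m, n) · C (m/n)^α`. [cite: WernerPCMI2009, Lecture 6, §3 (four arms from five arms, arXiv 0710.0856 p. 45)] [cite: Nolin2008, §6.2, proof of Thm. 27 (arXiv 0711.4948: Thm. 26)] -/
theorem Werner2009_fourArm_lowerBound_of_fiveArm_threeOpen
    (h5 : ∃ ε₁ > (0 : ℝ), ∀ ⦃ε : ℝ⦄, 0 < ε → ε < ε₁ →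
      ∃ r₁ : ℕ, ∃ δ > (0 : ℝ), ∃ c > (0 : ℝ),
        ∀ t : unitInterval, 1 / 2 ≤ (t : ℝ) → (t : ℝ) < 1 / 2 + δ →
          ∀ m n : ℕ, r₁ ≤ m → m ≤ n → (1 / 2 < (t : ℝ) → n ≤ charLengthW ε t) →
            c * ((m : ℝ) / n) ^ 2 ≤
              (triSitePercolation t).real (armEvent ![true, true, true, false, false] m n)) :
    Werner2009_fourArm_lowerBound := by
  obtain ⟨ε₁, hε₁, h5⟩ := h5
  refine ⟨ε₁, hε₁, fun ε hε hεε₁ => ?_⟩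
  obtain ⟨C, α, hC, hα, hone⟩ := exists_real_openArm_le_rpow_nearCritical hε
  obtain ⟨r₁, δ, hδ, c, hc, h⟩ := h5 hε hεε₁
  refine ⟨max r₁ 1, min δ (1 / 4), lt_min hδ (by norm_num), α, hα, c / C, div_pos hc hC,
    fun t ht htδ m n hm hmn hL => ?_⟩
  have htδ' : (t : ℝ) < 1 / 2 + δ := lt_of_lt_of_le htδ (by linarith [min_le_left δ (1 / 4)])
  have ht4 : (t : ℝ) < 3 / 4 := by linarith [min_le_right δ (1 / 4)]
  have hr₁m : r₁ ≤ m := le_trans (le_max_left _ _) hm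
  have h1m : 1 ≤ m := le_trans (le_max_right _ _) hm
  have hfive := h t ht htδ' m n hr₁m hmn hL
  have hsplit := real_fiveArm_threeOpen_le_fourArmProbAt_mul t hmn
  have harm := hone t ht ht4 m n h1m hmn hL
  -- `x = m / n ∈ (0, 1]`
  set x : ℝ := (m : ℝ) / n with hx
  have hm' : (0 : ℝ) < m := by exact_mod_cast h1m
  have hn' : (0 : ℝ) < n := by exact_mod_cast (lt_of_lt_of_le h1m hmn)
  have hxpos : 0 < x := div_pos hm' hn'
  have hxα : 0 < x ^ α := Real.rpow_pos_of_pos hxpos α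
  have h4 : 0 ≤ fourArmProbAt t m n := fourArmProbAt_nonneg t m n
  -- `c x² ≤ π̂ · C x^α`
  have key : c * x ^ 2 ≤ fourArmProbAt t m n * (C * x ^ α) :=
    hfive.trans (hsplit.trans (mul_le_mul_of_nonneg_left harm h4))
  have hCx : 0 < C * x ^ α := mul_pos hC hxα
  have hrpow : x ^ (2 - α) = x ^ 2 / x ^ α := by
    rw [Real.rpow_sub hxpos, Real.rpow_two]
  rw [hrpow]
  calc c / C * (x ^ 2 / x ^ α) = c * x ^ 2 / (C * x ^ α) := by
        field_simp
    _ ≤ fourArmProbAt t m n * (C * x ^ α) / (C * x ^ α) :=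
        div_le_div_of_nonneg_right key hCx.le
    _ = fourArmProbAt t m n := by
        field_simp

/-- **`Werner2009_fourArm_lowerBound` from the five-arm lower bound with three open arms, left of
`1/2`** (the side produced by the lowest OPEN crossing at densities `s ≤ 1/2`; Nolin 2008, §2.1:
the near-critical estimates hold "uniformly in `P̂` between `P_p` and `P_{1-p}`"). If for every
small `ε` there are `r₁, δ, c > 0` with `c (m/n)² ≤ P_s(armEvent (T,T,T,F,F) m n)` for
`1/2 - δ < s ≤ 1/2`, `r₁ ≤ m ≤ n`, `n ≤ L(s, ε)` when `s < 1/2`, then the named fact holds: by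
colour exchange (`real_fiveArm_symm`, `charLengthW_symm`) this is the hypothesis of
`Werner2009_fourArm_lowerBound_of_fiveArm` at `t = 1 - s`. [cite: WernerPCMI2009, Lecture 6, §3 (four arms from five arms)] [cite: Nolin2008, §2.1 and §6.2 (proof of Thm. 27; arXiv 0711.4948: Thm. 26)] [cite: SmirnovWernerMRL2001, Rem. 2] -/
theorem Werner2009_fourArm_lowerBound_of_fiveArm_threeOpen_left
    (h5 : ∃ ε₁ > (0 : ℝ), ∀ ⦃ε : ℝ⦄, 0 < ε → ε < ε₁ →
      ∃ r₁ : ℕ, ∃ δ > (0 : ℝ), ∃ c > (0 : ℝ),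
        ∀ s : unitInterval, 1 / 2 - δ < (s : ℝ) → (s : ℝ) ≤ 1 / 2 →
          ∀ m n : ℕ, r₁ ≤ m → m ≤ n → ((s : ℝ) < 1 / 2 → n ≤ charLengthW ε s) →
            c * ((m : ℝ) / n) ^ 2 ≤
              (triSitePercolation s).real (armEvent ![true, true, true, false, false] m n)) :
    Werner2009_fourArm_lowerBound := by
  refine Werner2009_fourArm_lowerBound_of_fiveArm ?_
  obtain ⟨ε₁, hε₁, h5⟩ := h5
  refine ⟨ε₁, hε₁, fun ε hε hεε₁ => ?_⟩
  obtain ⟨r₁, δ, hδ, c, hc, h⟩ := h5 hε hεε₁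
  refine ⟨r₁, δ, hδ, c, hc, fun t ht htδ m n hm hmn hL => ?_⟩
  have hs : ((σ t : unitInterval) : ℝ) = 1 - (t : ℝ) := unitInterval.coe_symm_eq t
  have key := h (σ t) (by rw [hs]; linarith) (by rw [hs]; linarith) m n hm hmn fun hlt => by
    rw [charLengthW_symm]
    exact hL (by rw [hs] at hlt; linarith)
  have hflip : (triSitePercolation t).real (armEvent ![true, false, true, false, false] m n) =
      (triSitePercolation (σ t)).real (armEvent ![true, true, true, false, false] m n) := by
    rw [← real_fiveArm_symm (σ t) m n, unitInterval.symm_symm]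
  rw [hflip]
  exact key

/-- **`Werner2009_fourArm_lowerBound` from the two-sided five-arm lower bound with three open
arms** (`|s - 1/2| < δ`, `n ≤ L(s, ε)` for `s ≠ 1/2`; Nolin 2008, Thm. 24 (ii) with Thm. 27,
"uniformly in `p`, `P̂` between `P_p` and `P_{1-p}` and `n ≤ N ≤ L(p)`"): restrict to
`s ≥ 1/2` and apply `Werner2009_fourArm_lowerBound_of_fiveArm_threeOpen`. [cite: Nolin2008, Thm. 24 (ii) and Thm. 27 (arXiv 0711.4948: Thm. 23 (ii), Thm. 26)] [cite: WernerPCMI2009, Lecture 6, §3] -/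
theorem Werner2009_fourArm_lowerBound_of_fiveArm_threeOpen_twoSided
    (h5 : ∃ ε₁ > (0 : ℝ), ∀ ⦃ε : ℝ⦄, 0 < ε → ε < ε₁ →
      ∃ r₁ : ℕ, ∃ δ > (0 : ℝ), ∃ c > (0 : ℝ),
        ∀ s : unitInterval, |(s : ℝ) - 1 / 2| < δ →
          ∀ m n : ℕ, r₁ ≤ m → m ≤ n → ((s : ℝ) ≠ 1 / 2 → n ≤ charLengthW ε s) →
            c * ((m : ℝ) / n) ^ 2 ≤
              (triSitePercolation s).real (armEvent ![true, true, true, false, false] m n)) :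
    Werner2009_fourArm_lowerBound := by
  refine Werner2009_fourArm_lowerBound_of_fiveArm_threeOpen ?_
  obtain ⟨ε₁, hε₁, h5⟩ := h5
  refine ⟨ε₁, hε₁, fun ε hε hεε₁ => ?_⟩
  obtain ⟨r₁, δ, hδ, c, hc, h⟩ := h5 hε hεε₁
  refine ⟨r₁, δ, hδ, c, hc, fun t ht htδ m n hm hmn hL => h t ?_ m n hm hmn fun hne => ?_⟩
  · rw [abs_sub_lt_iff]
    constructor <;> linarith
  · exact hL (lt_of_le_of_ne ht (Ne.symm hne))

end Literature.Probability.Percolation
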